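import Literature.AnabelianGeometry.EtaleTheta.Discharge.Sec5Prop53AllOrders
import Literature.AnabelianGeometry.EtaleTheta.Discharge.Sec5Prop53ChainModel
import Literature.AnabelianGeometry.EtaleTheta.Discharge.Sec5Prop53CriteriaToyNVSurjection
import Literature.AnabelianGeometry.EtaleTheta.Discharge.Sec5Prop53CriteriaToyNVAdjacency
import HarnessLib

/-!
# [EtTh] §5, Prop. 5.3 (i)–(vi) over ORDER COORDINATES with print's CRITERIA in place of clause (iv), and the JOINT
# non-vacuity of ALL its binders at ONE perfect datum (abc-iut-f-128's chain model) — row F-2497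

Mochizuki, *The étale theta function and its Frobenioid-theoretic manifestations*, Publ. RIMS **45** (2009), §5, Prop. 5.3
(i)–(vi) pp. 325–326 (PDF pp. 99–100), proof pp. 326–327 (PDF pp. 100–101) [cite: MochizukiEtTh2009, Prop 5.3 p.325 (PDF p.99)];
§1 p. 240 (PDF p. 14) (degrees on the chain); Prop. 5.1 p. 323 (PDF p. 97) (`Φ(−)` PERFECT).  Cell abc-iut, block F, seat
abc-iut-f-127 (gen 2).  PROOF-ONLY (no `def`, no instance, nothing landed is edited) over abc-iut-f-128's `Sec5Prop53AllOrders.lean`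
(`geometryOfDivisorsPreserved_of_orders`: the F-2497 assembly over order coordinates, clause (iv) itself a binder `hiv`),
`Sec5Prop53ChainModel.lean` (the chain model `chainTheta` / `chainPrimeData`: `Φ(A_⊚) = ⊕_{ℤ ⊔ ℤ} ℚ_{≥0}`, `Aut_C(A_⊚) ≅ ℤ`
translating the chain, `e = reindex (chainAut ε c)`), and this seat's `Sec5Prop53SurjectionOrders.lean` (p439550: (iv) from
print's p.326 clauses), `Sec5Prop53ToyChainGeometry.lean` / `Sec5Prop53CriteriaToyNV{Surjection,Adjacency}.lean` (p444580 /
p444703 / p444810: the coefficient factorization `toyFactor`, the degree-zero classes `toyPrincipal`, and the p.326/327 criteria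
kernel-verified on the chain).

RESULTS.
* `geometryOfDivisorsPreserved_of_orders_criteria` — the F-2497 instance form stated PURELY over order coordinates and print's
  criteria: f-128's `geometryOfDivisorsPreserved_of_orders` with the binder `hiv` (clause (iv)) REPLACED by the two p.326 clauses
  `hW` / `hCrit` (the description of `Prime^csp ↠ Prime^ncsp`), through `preservesCspToNcsp_of_orders`.
* **`allOrders_binders_chain`** — at the chain model, for every chain automorphism `(ε, c)` (reflections included), ALL binders of
  that form hold SIMULTANEOUSLY for ONE choice `factor := toyFactor`, `P := toyPrincipal`, `κ := 0`, `θ := 𝟙_{0}`, `s := 0`: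
  `hψo`, `hφ`, `hisoN`, `hisoC`, `hP` (degree-zero classes are preserved by reflections too: `deg_k ∘ e^gp = deg_{ε(k−c)}`),
  `hAdj`, `hW`, `hCrit` (abc-iut-f-128's `chainPrimeData` has LITERALLY abc-iut-f-009's toy fields, so the toy certificates
  transfer definitionally), `hsep`, `hcusp`, `hdiv`, `hAutO`, `hAut`, `htrans` — the joint non-vacuity of the order form of F-2497
  at a datum with PERFECT `Φ(A_⊚)` (where the form of record `geometryOfDivisorsPreserved_of_supportData'` is vacuous,
  `isEmpty_divisorSupportData'_toy`) and NON-TRIVIAL `Ψ^Φ_{A_⊚}` / `Aut_C(A_⊚)`;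
* `geometryOfDivisorsPreserved_chain_viaOrdersCriteria` — hence (i)–(vi) at the chain model for every transport stub admitting `e`,
  DERIVED THROUGH the order form (f-128's `geometryOfDivisorsPreserved_chain` proves the same clauses directly).

HONEST FRAMING: kernel statements about OUR binders at a TOY datum; nothing about the tempered Frobenioid of [EtTh] §5 or
[IUTchIII] Cor. 3.12; no side taken; typed ≠ proved.
-/

namespace Literature.AnabelianGeometry.EtaleTheta

namespace FrobenioidThetaDivisors

open CategoryTheory
open Literature.AlgebraicGeometry.Frobenioids

universe w v v' u u'

section Criteria

variable {C : Type u} [Category.{v} C] {D : Type u'} [Category.{v'} D] {𝔉 : ThetaFrobenioid.{w} C D}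
  {𝔓 : DivisorPrimeData 𝔉} (Ψ : C ≌ C) (ι : Ψ.functor.obj 𝔉.Acirc ≅ 𝔉.Acirc)
  (e : 𝔉.PhiAcirc ≃* 𝔉.pre.Mon (𝔉.base.obj (Ψ.functor.obj 𝔉.Acirc)))

/-- **[EtTh] Prop. 5.3, all six parts, over ORDER COORDINATES and print's CRITERIA (row F-2497)** — abc-iut-f-128's
`geometryOfDivisorsPreserved_of_orders` with clause (iv) no longer a binder: it is DERIVED from the p.326 description of the
surjection `Prime^csp ↠ Prime^ncsp` — it occurs at every cusp (`hW`) and pins the value (`hCrit`) — through this seat's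
`preservesCspToNcsp_of_orders` (row F-0560).  Every remaining binder is structural (one product-valued factorization and what
`Ψ^Φ_{A_⊚}` / `Aut_C(A_⊚)` do to it) or a printed criterion (`hAdj`, `hW`, `hCrit`; GAP-LEDGER G-L2d4-2).
[cite: MochizukiEtTh2009, Prop 5.3 p.325–326 (PDF pp.99–100); proof p.326–327 (PDF pp.100–101)] -/
theorem geometryOfDivisorsPreserved_of_orders_criteria (T : DivisorTransportStub 𝔉) (hind : T.IsInducedBy Ψ 𝔉.Acirc e)
    (hi : PreservesCuspidality T 𝔓 Ψ ι e)
    (factor : 𝔉.PhiAcirc →* (Primes 𝔉.PhiAcirc → Multiplicative ℚ))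
    (hψo : ∀ (𝔭 : Primes 𝔉.PhiAcirc) (a : 𝔉.PhiAcirc),
      ordOf' factor (Primes.congr (psiPhi 𝔉 Ψ ι e) 𝔭) (psiPhi 𝔉 Ψ ι e a) = ordOf' factor 𝔭 a)
    (hφ : ∀ 𝔭 : Primes 𝔉.PhiAcirc, Function.Injective fun x : ↥𝔭.submonoid => ordOf' factor 𝔭 x)
    (hisoN : ∀ (p q : Primes 𝔉.PhiAcirc) (hp : ¬ 𝔓.IsCuspidal p) (hq : ¬ 𝔓.IsCuspidal q) (x : ↥p.submonoid),
      ordOf' factor q (𝔓.ncspIso p q hp hq x) = ordOf' factor p x)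
    (hisoC : ∀ (p q : Primes 𝔉.PhiAcirc) (hp : 𝔓.IsCuspidal p) (hq : 𝔓.IsCuspidal q) (x : ↥p.submonoid),
      ordOf' factor q (𝔓.cspIso p q hp hq x) = ordOf' factor p x)
    (P : Subgroup (Algebra.GrothendieckGroup 𝔉.PhiAcirc))
    (hP : ∀ x, ThetaFrobenioid.gpMap (psiPhi 𝔉 Ψ ι e).toMonoidHom x ∈ P ↔ x ∈ P)
    (hAdj : ∀ (𝔭 𝔮 : Primes 𝔉.PhiAcirc) (h𝔭 : ¬ 𝔓.IsCuspidal 𝔭) (h𝔮 : ¬ 𝔓.IsCuspidal 𝔮), 𝔭 ≠ 𝔮 →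
      ∀ a : 𝔭.submonoid, (a : 𝔉.PhiAcirc) ∈ 𝔭.carrier →
        (Adjacent 𝔓 ⟨𝔭, h𝔭⟩ ⟨𝔮, h𝔮⟩ ↔
          ∀ c, IsCuspidallyMinimalOf' 𝔓 factor P c →
            LinEquivOf P c (Algebra.GrothendieckGroup.of (a : 𝔉.PhiAcirc) *
              Algebra.GrothendieckGroup.of (𝔓.ncspIso 𝔭 𝔮 h𝔭 h𝔮 a : 𝔉.PhiAcirc)) →
            (suppOf' factor c).ncard = 4))
    (hW : ∀ 𝔞 : Primes 𝔉.PhiAcirc, 𝔓.IsCuspidal 𝔞 → ∃ (𝔫 : Primes 𝔉.PhiAcirc) (_ : ¬ 𝔓.IsCuspidal 𝔫)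
      (a b n : 𝔉.PhiAcirc), a ∈ 𝔞.carrier ∧ n ∈ 𝔫.carrier ∧
        IsCuspidalGpOf' 𝔓 factor (Algebra.GrothendieckGroup.of b) ∧
        CoprimeOf' factor (Algebra.GrothendieckGroup.of a) (Algebra.GrothendieckGroup.of b) ∧
        IsCuspidallyMinimalOf' 𝔓 factor P
          (Algebra.GrothendieckGroup.of b * (Algebra.GrothendieckGroup.of a)⁻¹) ∧
        LinEquivOf P (Algebra.GrothendieckGroup.of b * (Algebra.GrothendieckGroup.of a)⁻¹)
          (Algebra.GrothendieckGroup.of n))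
    (hCrit : ∀ (𝔞 𝔫 : Primes 𝔉.PhiAcirc) (h𝔞 : 𝔓.IsCuspidal 𝔞) (h𝔫 : ¬ 𝔓.IsCuspidal 𝔫) (a b n : 𝔉.PhiAcirc),
      a ∈ 𝔞.carrier → n ∈ 𝔫.carrier →
      IsCuspidalGpOf' 𝔓 factor (Algebra.GrothendieckGroup.of b) →
      CoprimeOf' factor (Algebra.GrothendieckGroup.of a) (Algebra.GrothendieckGroup.of b) →
      IsCuspidallyMinimalOf' 𝔓 factor P
        (Algebra.GrothendieckGroup.of b * (Algebra.GrothendieckGroup.of a)⁻¹) →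
      LinEquivOf P (Algebra.GrothendieckGroup.of b * (Algebra.GrothendieckGroup.of a)⁻¹)
        (Algebra.GrothendieckGroup.of n) →
      𝔓.cspToNcsp ⟨𝔞, h𝔞⟩ = ⟨𝔫, h𝔫⟩)
    (hsep : ∀ x y : Algebra.GrothendieckGroup 𝔉.PhiAcirc,
      (∀ 𝔭, Multiplicative.toAdd (ordGpOf' factor 𝔭 x) = Multiplicative.toAdd (ordGpOf' factor 𝔭 y)) → x = y)
    (κ : ℚ) (θ : ℤ → ℚ) (s : ℤ) (hθ : ∀ j, θ (s - j) = θ j)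
    (hcusp : ∀ 𝔠, 𝔓.IsCuspidal 𝔠 → Multiplicative.toAdd (ordGpOf' factor 𝔠 𝔓.divTheta) = κ)
    (hdiv : ∀ (𝔫 : Primes 𝔉.PhiAcirc) (h𝔫 : ¬ 𝔓.IsCuspidal 𝔫),
      Multiplicative.toAdd (ordGpOf' factor 𝔫 𝔓.divTheta) = θ (𝔓.ncspEquivZ ⟨𝔫, h𝔫⟩))
    (hAutO : ∀ (g : Aut 𝔉.Acirc) (𝔭 : Primes 𝔉.PhiAcirc) (a : 𝔉.PhiAcirc),
      ordOf' factor (Primes.congr (𝔉.pullAut g) 𝔭) (𝔉.pullAut g a) = ordOf' factor 𝔭 a)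
    (hAut : ∀ g : Aut 𝔉.Acirc, (∀ 𝔭, 𝔓.IsCuspidal (Primes.congr (𝔉.pullAut g) 𝔭) ↔ 𝔓.IsCuspidal 𝔭) ∧
      ∃ (ε : ℤˣ) (c : ℤ), ∀ (𝔭 : Primes 𝔉.PhiAcirc) (h𝔭 : ¬ 𝔓.IsCuspidal 𝔭)
        (h𝔭' : ¬ 𝔓.IsCuspidal (Primes.congr (𝔉.pullAut g) 𝔭)),
        𝔓.ncspEquivZ ⟨Primes.congr (𝔉.pullAut g) 𝔭, h𝔭'⟩ = ε * 𝔓.ncspEquivZ ⟨𝔭, h𝔭⟩ + c)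
    (htrans : ∀ t : ℤ, ∃ g : Aut 𝔉.Acirc,
      (∀ 𝔭, 𝔓.IsCuspidal (Primes.congr (𝔉.pullAut g) 𝔭) ↔ 𝔓.IsCuspidal 𝔭) ∧
      ∀ (𝔭 : Primes 𝔉.PhiAcirc) (h𝔭 : ¬ 𝔓.IsCuspidal 𝔭) (h𝔭' : ¬ 𝔓.IsCuspidal (Primes.congr (𝔉.pullAut g) 𝔭)),
        𝔓.ncspEquivZ ⟨Primes.congr (𝔉.pullAut g) 𝔭, h𝔭'⟩ = 𝔓.ncspEquivZ ⟨𝔭, h𝔭⟩ + t) :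
    GeometryOfDivisorsPreserved T 𝔓 Ψ ι e :=
  geometryOfDivisorsPreserved_of_orders Ψ ι e T hind hi factor hψo hφ hisoN hisoC P hP hAdj
    (preservesCspToNcsp_of_orders 𝔓 Ψ ι e factor P (hi hind).2.2 hψo hP hW hCrit) hsep κ θ s hθ hcusp hdiv hAutO hAut htrans

end Criteria

/-! ### The chain model: every binder at once -/

namespace Prop53Chain

open ConstantMultiple ConstantMultiple.Cor512Toy Prop53Toy

/-- `Ψ^Φ_{A_⊚}` of the chain model for `e = reindex σ` IS the toy's `psiToy σ` on primes … [cite: MochizukiEtTh2009, Prop 5.3 p.325 (PDF p.99)] -/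
theorem congr_psiPhi_chain_eq (σ : Idx ≃ Idx) (𝔭 : Primes Φt) :
    Primes.congr (psiPhi chainTheta Ψ₁ ι₁ (reindex σ)) 𝔭 = Primes.congr (psiToy σ) 𝔭 := by
  rw [psiPhi_chain]; rfl

/-- … and on elements. [cite: MochizukiEtTh2009, Prop 5.3 p.325 (PDF p.99)] -/
theorem psiPhi_chain_apply_eq (σ : Idx ≃ Idx) (a : Φt) : psiPhi chainTheta Ψ₁ ι₁ (reindex σ) a = psiToy σ a :=
  (MulEquiv.congr_fun (psiPhi_chain (reindex σ)) a).trans (psiToy_apply σ a).symm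

/-- … and as a homomorphism (for `(Ψ^Φ)^gp`). [cite: MochizukiEtTh2009, Prop 5.3 p.325 (PDF p.99)] -/
theorem psiPhi_chain_toMonoidHom_eq (σ : Idx ≃ Idx) :
    (psiPhi chainTheta Ψ₁ ι₁ (reindex σ)).toMonoidHom = (psiToy σ).toMonoidHom := by
  rw [psiPhi_chain]; rfl

/-- `Aut_C(A_⊚)` acts through the toy's `psiToy (shift k)` on primes … [cite: MochizukiEtTh2009, Prop 5.3 (vi) p.326 (PDF p.100)] -/
theorem congr_pullAut_chain_eq (g : Aut chainTheta.Acirc) (𝔭 : Primes Φt) :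
    Primes.congr (chainTheta.pullAut g) 𝔭 = Primes.congr (psiToy (shift (Multiplicative.toAdd g.inv))) 𝔭 := by
  rw [MulEquiv.ext (pullAut_chain g)]; rfl

/-- … and on elements. [cite: MochizukiEtTh2009, Prop 5.3 (vi) p.326 (PDF p.100)] -/
theorem pullAut_chain_apply_eq (g : Aut chainTheta.Acirc) (a : Φt) :
    chainTheta.pullAut g a = psiToy (shift (Multiplicative.toAdd g.inv)) a :=
  (pullAut_chain g a).trans (psiToy_apply _ a).symm

/-- `Aut_C(A_⊚)` acts through chain translations, as isomorphisms of monoids. [cite: MochizukiEtTh2009, Prop 5.3 (vi) p.326 (PDF p.100)] -/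
theorem pullAut_chain_eq (g : Aut chainTheta.Acirc) : chainTheta.pullAut g = reindex (shift (Multiplicative.toAdd g.inv)) :=
  MulEquiv.ext (pullAut_chain g)

/-- **`hP` for every chain automorphism, reflections included**: `(Ψ^Φ)^gp` preserves the degree-zero classes, because
`deg_k ∘ e^gp = deg_{ε(k − c)}` (for `ε = −1` the two neighbours are swapped). [cite: MochizukiEtTh2009, §1 p.240 (PDF p.14)] -/
theorem gpMap_psiToy_chainAut_mem_toyPrincipal_iff (ε : ℤˣ) (c : ℤ) (x : GpToy) :
    ThetaFrobenioid.gpMap (psiToy (chainAut ε c)).toMonoidHom x ∈ toyPrincipal ↔ x ∈ toyPrincipal := by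
  rw [mem_toyPrincipal_iff, mem_toyPrincipal_iff]
  simp only [cf_gpMap_psiToy, chainAut_symm_inl, chainAut_symm_inr]
  rcases Int.units_eq_one_or ε with rfl | rfl
  · simp only [Units.val_one, one_mul]
    constructor
    · intro h k
      have := h (k + c)
      rwa [show k + c - 1 - c = k - 1 by ring, show k + c - c = k by ring, show k + c + 1 - c = k + 1 by ring] at this
    · intro h k
      have := h (k - c)
      rwa [show k - c - 1 = k - 1 - c by ring, show k - c + 1 = k + 1 - c by ring] at this
  · simp only [Units.val_neg, Units.val_one, neg_mul, one_mul]
    constructor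
    · intro h k
      have := h (c - k)
      rw [show -(c - k - 1 - c) = k + 1 by ring, show -(c - k - c) = k by ring, show -(c - k + 1 - c) = k - 1 by ring] at this
      linarith
    · intro h k
      have := h (-(k - c))
      rw [show -(k - c) - 1 = -(k + 1 - c) by ring, show -(k - c) + 1 = -(k - 1 - c) by ring] at this
      linarith

/-- **`hφ`**: the order at `𝔭` is injective on the primary component `Φ(A_⊚)_𝔭` (a copy of `ℚ_{≥0}` read by one coefficient).
[cite: MochizukiEtTh2009, Prop 3.2 (i) p.296 (PDF p.70)] -/
theorem injective_ordOf'_toyFactor (𝔭 : Primes PhiToy) : Function.Injective fun x : ↥𝔭.submonoid => ordOf' toyFactor 𝔭 x := by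
  intro x y h
  have h' := congrArg Multiplicative.toAdd h
  simp only [toAdd_ordOf'_toyFactor] at h'
  have h'' := NNRat.coe_injective h'
  apply (DirectSum.submonoidEquiv fac_monoprime 𝔭 (idx 𝔭) (P_idx 𝔭)).injective
  apply Multiplicative.toAdd.injective
  exact h''

/-- **`hisoN` / `hisoC`**: the canonical component isomorphisms preserve the order (both read off one coefficient).
[cite: MochizukiEtTh2009, Prop 5.3 (ii) p.325 (PDF p.99)] -/
theorem ordOf'_toyFactor_canonIso (p q : Primes PhiToy) (x : ↥p.submonoid) :
    ordOf' toyFactor q (canonIso p q x : Φt) = ordOf' toyFactor p x := by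
  apply Multiplicative.toAdd.injective
  rw [toAdd_ordOf'_toyFactor, toAdd_ordOf'_toyFactor, canonIso_val, DirectSum.single_apply_same]

/-- **ALL binders of the order-coordinate form of [EtTh] Prop. 5.3 (i)–(vi) hold at once at the chain model** — for every chain
automorphism `e = reindex (chainAut ε c)`, with `factor := toyFactor` (coefficient embedding), `P := toyPrincipal` (degree-zero
classes), `κ := 0`, `θ := 𝟙_{0}`, `s := 0`: `hψo`, `hφ`, `hisoN`, `hisoC`, `hP`, `hAdj`, `hW`, `hCrit`, `hsep`, `hθ`, `hcusp`,
`hdiv`, `hAutO`, `hAut`, `htrans` — the JOINT NON-VACUITY certificate of the F-2497 order form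
(`geometryOfDivisorsPreserved_of_orders_criteria`) at a PERFECT `Φ(A_⊚)` with non-trivial `Ψ^Φ_{A_⊚}` and `Aut_C(A_⊚)`.
[cite: MochizukiEtTh2009, Prop 5.3 proof p.326–327 (PDF pp.100–101); §1 p.240 (PDF p.14)] -/
theorem allOrders_binders_chain (ε : ℤˣ) (c : ℤ) :
    ∃ (factor : chainTheta.PhiAcirc →* (Primes chainTheta.PhiAcirc → Multiplicative ℚ))
      (P : Subgroup (Algebra.GrothendieckGroup chainTheta.PhiAcirc)) (κ : ℚ) (θ : ℤ → ℚ) (s : ℤ),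
      (∀ (𝔭 : Primes chainTheta.PhiAcirc) (a : chainTheta.PhiAcirc),
        ordOf' factor (Primes.congr (psiPhi chainTheta Ψ₁ ι₁ (reindex (chainAut ε c))) 𝔭)
          (psiPhi chainTheta Ψ₁ ι₁ (reindex (chainAut ε c)) a) = ordOf' factor 𝔭 a) ∧
      (∀ 𝔭 : Primes chainTheta.PhiAcirc, Function.Injective fun x : ↥𝔭.submonoid => ordOf' factor 𝔭 x) ∧
      (∀ (p q : Primes chainTheta.PhiAcirc) (hp : ¬ chainPrimeData.IsCuspidal p) (hq : ¬ chainPrimeData.IsCuspidal q)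
        (x : ↥p.submonoid), ordOf' factor q (chainPrimeData.ncspIso p q hp hq x) = ordOf' factor p x) ∧
      (∀ (p q : Primes chainTheta.PhiAcirc) (hp : chainPrimeData.IsCuspidal p) (hq : chainPrimeData.IsCuspidal q)
        (x : ↥p.submonoid), ordOf' factor q (chainPrimeData.cspIso p q hp hq x) = ordOf' factor p x) ∧
      (∀ x, ThetaFrobenioid.gpMap (psiPhi chainTheta Ψ₁ ι₁ (reindex (chainAut ε c))).toMonoidHom x ∈ P ↔ x ∈ P) ∧
      (∀ (𝔭 𝔮 : Primes chainTheta.PhiAcirc) (h𝔭 : ¬ chainPrimeData.IsCuspidal 𝔭) (h𝔮 : ¬ chainPrimeData.IsCuspidal 𝔮),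
        𝔭 ≠ 𝔮 → ∀ a : 𝔭.submonoid, (a : chainTheta.PhiAcirc) ∈ 𝔭.carrier →
          (Adjacent chainPrimeData ⟨𝔭, h𝔭⟩ ⟨𝔮, h𝔮⟩ ↔
            ∀ x, IsCuspidallyMinimalOf' chainPrimeData factor P x →
              LinEquivOf P x (Algebra.GrothendieckGroup.of (a : chainTheta.PhiAcirc) *
                Algebra.GrothendieckGroup.of (chainPrimeData.ncspIso 𝔭 𝔮 h𝔭 h𝔮 a : chainTheta.PhiAcirc)) →
              (suppOf' factor x).ncard = 4)) ∧
      (∀ 𝔞 : Primes chainTheta.PhiAcirc, chainPrimeData.IsCuspidal 𝔞 →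
        ∃ (𝔫 : Primes chainTheta.PhiAcirc) (_ : ¬ chainPrimeData.IsCuspidal 𝔫) (a b n : chainTheta.PhiAcirc),
          a ∈ 𝔞.carrier ∧ n ∈ 𝔫.carrier ∧
          IsCuspidalGpOf' chainPrimeData factor (Algebra.GrothendieckGroup.of b) ∧
          CoprimeOf' factor (Algebra.GrothendieckGroup.of a) (Algebra.GrothendieckGroup.of b) ∧
          IsCuspidallyMinimalOf' chainPrimeData factor P
            (Algebra.GrothendieckGroup.of b * (Algebra.GrothendieckGroup.of a)⁻¹) ∧
          LinEquivOf P (Algebra.GrothendieckGroup.of b * (Algebra.GrothendieckGroup.of a)⁻¹)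
            (Algebra.GrothendieckGroup.of n)) ∧
      (∀ (𝔞 𝔫 : Primes chainTheta.PhiAcirc) (h𝔞 : chainPrimeData.IsCuspidal 𝔞) (h𝔫 : ¬ chainPrimeData.IsCuspidal 𝔫)
        (a b n : chainTheta.PhiAcirc), a ∈ 𝔞.carrier → n ∈ 𝔫.carrier →
        IsCuspidalGpOf' chainPrimeData factor (Algebra.GrothendieckGroup.of b) →
        CoprimeOf' factor (Algebra.GrothendieckGroup.of a) (Algebra.GrothendieckGroup.of b) →
        IsCuspidallyMinimalOf' chainPrimeData factor P
          (Algebra.GrothendieckGroup.of b * (Algebra.GrothendieckGroup.of a)⁻¹) →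
        LinEquivOf P (Algebra.GrothendieckGroup.of b * (Algebra.GrothendieckGroup.of a)⁻¹)
          (Algebra.GrothendieckGroup.of n) →
        chainPrimeData.cspToNcsp ⟨𝔞, h𝔞⟩ = ⟨𝔫, h𝔫⟩) ∧
      (∀ x y : Algebra.GrothendieckGroup chainTheta.PhiAcirc,
        (∀ 𝔭, Multiplicative.toAdd (ordGpOf' factor 𝔭 x) = Multiplicative.toAdd (ordGpOf' factor 𝔭 y)) → x = y) ∧
      (∀ j, θ (s - j) = θ j) ∧
      (∀ 𝔠, chainPrimeData.IsCuspidal 𝔠 → Multiplicative.toAdd (ordGpOf' factor 𝔠 chainPrimeData.divTheta) = κ) ∧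
      (∀ (𝔫 : Primes chainTheta.PhiAcirc) (h𝔫 : ¬ chainPrimeData.IsCuspidal 𝔫),
        Multiplicative.toAdd (ordGpOf' factor 𝔫 chainPrimeData.divTheta) = θ (chainPrimeData.ncspEquivZ ⟨𝔫, h𝔫⟩)) ∧
      (∀ (g : Aut chainTheta.Acirc) (𝔭 : Primes chainTheta.PhiAcirc) (a : chainTheta.PhiAcirc),
        ordOf' factor (Primes.congr (chainTheta.pullAut g) 𝔭) (chainTheta.pullAut g a) = ordOf' factor 𝔭 a) ∧
      (∀ g : Aut chainTheta.Acirc,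
        (∀ 𝔭, chainPrimeData.IsCuspidal (Primes.congr (chainTheta.pullAut g) 𝔭) ↔ chainPrimeData.IsCuspidal 𝔭) ∧
        ∃ (ε' : ℤˣ) (c' : ℤ), ∀ (𝔭 : Primes chainTheta.PhiAcirc) (h𝔭 : ¬ chainPrimeData.IsCuspidal 𝔭)
          (h𝔭' : ¬ chainPrimeData.IsCuspidal (Primes.congr (chainTheta.pullAut g) 𝔭)),
          chainPrimeData.ncspEquivZ ⟨Primes.congr (chainTheta.pullAut g) 𝔭, h𝔭'⟩ =
            ε' * chainPrimeData.ncspEquivZ ⟨𝔭, h𝔭⟩ + c') ∧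
      (∀ t : ℤ, ∃ g : Aut chainTheta.Acirc,
        (∀ 𝔭, chainPrimeData.IsCuspidal (Primes.congr (chainTheta.pullAut g) 𝔭) ↔ chainPrimeData.IsCuspidal 𝔭) ∧
        ∀ (𝔭 : Primes chainTheta.PhiAcirc) (h𝔭 : ¬ chainPrimeData.IsCuspidal 𝔭)
          (h𝔭' : ¬ chainPrimeData.IsCuspidal (Primes.congr (chainTheta.pullAut g) 𝔭)),
          chainPrimeData.ncspEquivZ ⟨Primes.congr (chainTheta.pullAut g) 𝔭, h𝔭'⟩ =
            chainPrimeData.ncspEquivZ ⟨𝔭, h𝔭⟩ + t) := by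
  refine ⟨toyFactor, toyPrincipal, 0, fun j => if j = 0 then 1 else 0, 0, ?_, injective_ordOf'_toyFactor,
    fun p q _ _ x => ordOf'_toyFactor_canonIso p q x, fun p q _ _ x => ordOf'_toyFactor_canonIso p q x, ?_,
    adjacencyCriterion_toy, cspToNcspWitnessed_toy, cspToNcspCriterion_toy, fun x y h => eq_of_cf_eq fun i => h (Pt i),
    fun j => by simp only [zero_sub, neg_eq_zero], fun 𝔠 h𝔠 => ?_, fun 𝔫 h𝔫 => ?_, fun g 𝔭 a => ?_, fun g => ?_,
    fun t => ?_⟩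
  · -- `hψo`
    intro 𝔭 a
    rw [congr_psiPhi_chain_eq, psiPhi_chain_apply_eq]
    exact ordMap_toy _ 𝔭 a
  · -- `hP`
    intro x
    rw [psiPhi_chain_toMonoidHom_eq]
    exact gpMap_psiToy_chainAut_mem_toyPrincipal_iff ε c x
  · -- `hcusp`: `div(Θ̈) = [x_{inl 0}]` has order `0` at every cusp
    obtain ⟨n, hn⟩ := h𝔠
    refine (toAdd_ordGpOf'_eq_cf 𝔠 _).trans ?_
    change cf (idx 𝔠) (Algebra.GrothendieckGroup.of (DirectSum.single (M := Fac) (Sum.inl 0) (Multiplicative.ofAdd 1))) = 0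
    rw [cf_of_single, hn]
    simp
  · -- `hdiv`: … and order `𝟙_{0}(label)` at the components
    obtain ⟨n, hn⟩ := idx_eq_inl_of_not_isCusp h𝔫
    refine (toAdd_ordGpOf'_eq_cf 𝔫 _).trans ?_
    change cf (idx 𝔫) (Algebra.GrothendieckGroup.of (DirectSum.single (M := Fac) (Sum.inl 0) (Multiplicative.ofAdd 1))) =
      if label 𝔫 = 0 then (1 : ℚ) else 0
    rw [cf_of_single, hn, label_of_idx (Or.inl hn)]
    simp only [Sum.inl.injEq]
    split_ifs <;> rfl
  · -- `hAutO`
    rw [congr_pullAut_chain_eq, pullAut_chain_apply_eq]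
    exact ordMap_toy _ 𝔭 a
  · -- `hAut`
    refine ⟨isCusp_congr_chainAut 1 _ _ (pullAut_chain_eq g), 1, Multiplicative.toAdd g.inv, fun 𝔭 h𝔭 _ => ?_⟩
    obtain ⟨n, hn⟩ := idx_eq_inl_of_not_isCusp h𝔭
    exact label_congr_chainAut 1 _ _ (pullAut_chain_eq g) hn
  · -- `htrans`
    obtain ⟨g, hg⟩ := exists_aut_translate t
    refine ⟨g, isCusp_congr_chainAut 1 _ _ (pullAut_chain_eq g), fun 𝔭 h𝔭 _ => ?_⟩
    obtain ⟨n, hn⟩ := idx_eq_inl_of_not_isCusp h𝔭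
    exact (label_congr_chainAut 1 _ _ (pullAut_chain_eq g) hn).trans (by rw [Units.val_one, one_mul, hg]; rfl)

/-- **[EtTh] Prop. 5.3 (i)–(vi) at the chain model, DERIVED THROUGH the order-coordinate form with print's criteria**
(`geometryOfDivisorsPreserved_of_orders_criteria`, all binders discharged by `allOrders_binders_chain`), for every transport stub
`T` admitting `e = reindex (chainAut ε c)` — the same clauses abc-iut-f-128 proves directly (`geometryOfDivisorsPreserved_chain`),
here reached along print's route. [cite: MochizukiEtTh2009, Prop 5.3 p.325–326 (PDF pp.99–100); proof p.326–327 (PDF pp.100–101)] -/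
theorem geometryOfDivisorsPreserved_chain_viaOrdersCriteria (ε : ℤˣ) (c : ℤ) (T : DivisorTransportStub chainTheta)
    (hind : T.IsInducedBy Ψ₁ chainTheta.Acirc (reindex (chainAut ε c))) :
    GeometryOfDivisorsPreserved T chainPrimeData Ψ₁ ι₁ (reindex (chainAut ε c)) := by
  obtain ⟨factor, P, κ, θ, s, hψo, hφ, hisoN, hisoC, hP, hAdj, hW, hCrit, hsep, hθ, hcusp, hdiv, hAutO, hAut, htrans⟩ :=
    allOrders_binders_chain ε c
  exact geometryOfDivisorsPreserved_of_orders_criteria Ψ₁ ι₁ _ T hind (preservesCuspidality_chain ε c T) factor hψo hφ hisoN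
    hisoC P hP hAdj hW hCrit hsep κ θ s hθ hcusp hdiv hAutO hAut htrans

end Prop53Chain

end FrobenioidThetaDivisors

end Literature.AnabelianGeometry.EtaleTheta
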